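import Mathlib
import Summits.PneNP.PneNP.Theses.LatticeMagic
import Literature.Computability.MetaComplexity.XorPseudoexpectation

/-!
# PneNP / LatticeMagic — `BooleanSosBlindAtConstantFactor`, line `Sketch` (Construction-A road): shared definitions

Route-posited objects of the crux line `Sketch` for crux `BooleanSosBlindAtConstantFactor`
(item stmt-PneNP-2330; skeleton `Cruxes/BooleanSosBlindAtConstantFactor/Lines/Sketch.lean`, idea cards
`construction-a-gs-pullback` / `construction-a-xor-embedding`). This file is the single home of the
line's vocabulary, so that the stub files (`--supports stmt-PneNP-2330`) and the closing composition
share ONE copy of every definition: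

* §1 `closenessPoly p m` — the bit-encoded closeness polynomial of the crux, copied VERBATIM from the
  route decl, and `Fooled D p m` — "degree-`D` Boolean SOS (tree vocabulary `IsPseudoexpectation`,
  `SatisfiesIdentity`, `boolAxiom`, KMOW primal form) does not refute the closeness system of `(p, m)`";
  `crux_iff` records that the crux is literally `∃ γ₀ δ C, ∀ n₀, ∃ p m, … ∧ Fooled ⌈n^δ⌉₊ p m` (`Iff.rfl`).
* §2 the Construction-A `GapCVP` instance of a family of clauses `C : Fin me → Clause ℕ` over `N`
  variables (read as the 3-XOR system "odd number of true literals per clause", i.e.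
  `Σ_{v ∈ scope (C e)} x_v ≡ rhsBit (C e) (mod 2)`): dimension `N + me`, basis rows
  `b_i = 2 e_i + Σ_{e : i ∈ scope (C e)} e_{N+e}` (`i < N`) and `b_{N+e} = 2 e_{N+e}` (block upper
  triangular, `conABasis`), target `t = (1, …, 1 | rhsBit (C e))` (`conATarget`), threshold `d₀`
  (`conAInstance`); and the integer-parity unsatisfiability predicate `XorUnsat` consumed by the
  NO-instance stub.

Sources for the notions: Conway–Sloane Construction A / Micciancio–Goldwasser 2002 Ch. 1 (codes ↦
lattices `𝒞 + 2ℤⁿ`), Grigoriev 2001 / Schoenebeck 2008 (parity pseudo-moments; tree files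
`XorDerivation.lean`, `XorPseudoexpectation.lean`), Kothari–Mori–O'Donnell–Witmer 2017 Def. 2.7–2.8
(pseudoexpectations; tree file `SumOfSquares.lean`). Everything here is vocabulary (route-posited
objects, not cited facts); the line's STUBS (`stub_fooled`, `stub_no`, `stub_parity`, `stub_encode`) are
proved — or not — in the sibling stub files `LatticeMagicBooleanSosBlindAtConstantFactorStub*.lean`.
-/

set_option linter.dupNamespace false -- `Summit.PneNP.PneNP.…`: summit = sub-problem (D-0017)

namespace Summit.PneNP.PneNP.Theorems.ConA

open scoped BigOperators
open Literature.Algebra.EuclideanLattices Literature.Computability.Complexity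
  Literature.Computability.MetaComplexity

noncomputable section

/-! ## §1 The crux, read back -/

/-- The CLOSENESS POLYNOMIAL of the crux for an instance `p = ((B, t), d)` and bit budget `m`:
`‖z B − t‖² + Σ_{b<m} 2^b x_(b,0) − ⌊d²⌋` with `z_i = Σ_{b<m} 2^b x_(i,b+1) − 2^{m−1}` (two's complement),
variables indexed by `Nat.pair` — copied verbatim from the route decl
`Summit.PneNP.PneNP.Theses.LatticeMagic.BooleanSosBlindAtConstantFactor`. (line vocabulary) -/
def closenessPoly (p : GapCVPInstance) (m : ℕ) : MvPolynomial ℕ ℝ :=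
  (∑ k : Fin p.1.I.n, (∑ i : Fin p.1.I.n, ((∑ b ∈ Finset.range m, ((2 : ℝ) ^ b) •
    MvPolynomial.X (Nat.pair i.val (b + 1))) - MvPolynomial.C ((2 ^ (m - 1) : ℕ) : ℝ)) *
    MvPolynomial.C ((p.1.I.basis i k : ℤ) : ℝ) - MvPolynomial.C ((p.1.target k : ℤ) : ℝ)) ^ 2) +
    (∑ b ∈ Finset.range m, ((2 : ℝ) ^ b) • MvPolynomial.X (Nat.pair b 0)) -
    MvPolynomial.C ((⌊(p.2 : ℝ) ^ 2⌋ : ℤ) : ℝ)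

/-- "Degree-`D` Boolean SOS does NOT refute the closeness system of `(p, m)`": some degree-`D`
pseudoexpectation satisfies every Booleanity identity and the closeness identity (KMOW primal form,
tree vocabulary of `Literature/Computability/MetaComplexity/SumOfSquares.lean`). (line vocabulary) -/
def Fooled (D : ℕ) (p : GapCVPInstance) (m : ℕ) : Prop :=
  ∃ E : MvPolynomial ℕ ℝ →ₗ[ℝ] ℝ, IsPseudoexpectation D E ∧
    (∀ v : ℕ, SatisfiesIdentity D E (boolAxiom v)) ∧ SatisfiesIdentity D E (closenessPoly p m)

/-- Readback: the crux is LITERALLY `∃ γ₀ ≥ 1, ∃ δ > 0, ∃ C, ∀ n₀, ∃ p m, n₀ ≤ n ∧ p ∈ GapCVP.no γ₀ ∧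
|code p| ≤ n^C ∧ m ≤ n^C ∧ Fooled ⌈n^δ⌉₊ p m` (definitional unfolding only). (line vocabulary) -/
theorem crux_iff : Summit.PneNP.PneNP.Theses.LatticeMagic.BooleanSosBlindAtConstantFactor ↔
    ∃ γ₀ : ℝ, 1 ≤ γ₀ ∧ ∃ δ : ℝ, 0 < δ ∧ ∃ C : ℕ, ∀ n₀ : ℕ, ∃ (p : GapCVPInstance) (m : ℕ),
      n₀ ≤ p.1.I.n ∧ p ∈ GapCVP.no (fun _ => γ₀) ∧ (GapCVPInstance.encode p).length ≤ p.1.I.n ^ C ∧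
      m ≤ p.1.I.n ^ C ∧ Fooled ⌈(p.1.I.n : ℝ) ^ δ⌉₊ p m :=
  Iff.rfl

/-! ## §2 The Construction-A instance of a clause family -/

/-- The integer sign of a literal: `+1` for a positive literal `(v, true)`, `−1` for a negative one
(the integer shadow of the tree's real `litSign`). (line vocabulary) -/
def litSignZ (l : Literal ℕ) : ℤ :=
  if l.2 then 1 else -1

/-- The XOR right-hand side of a clause: the parity constraint "an odd number of literals of `C` is
true" reads `Σ_{v ∈ scope C} x_v ≡ rhsBit C (mod 2)` with `rhsBit C = 1` iff the number of negative
literals is even, i.e. iff `∏_l litSignZ l = 1` (equivalently `clauseSign C = −1`). (line vocabulary) -/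
def rhsBit (C : Clause ℕ) : ℤ :=
  if (C.map litSignZ).prod = 1 then 1 else 0

/-- The scope-incidence block: `incBlock N me C i e = 1` if the variable `i < N` occurs in the clause
`C e`, else `0` (an `N × me` integer matrix; column `e` is the indicator of `scope (C e)`).
(line vocabulary) -/
def incBlock (N me : ℕ) (C : Fin me → Clause ℕ) : Matrix (Fin N) (Fin me) ℤ :=
  Matrix.of fun i e => if (i : ℕ) ∈ clauseScope (C e) then 1 else 0

/-- The Construction-A basis of the clause family, dimension `N + me`: in block form (message block
`Fin N`, check block `Fin me`, glued by `finSumFinEquiv`) it is `[[2·I_N, incBlock], [0, 2·I_me]]`,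
i.e. rows `b_i = 2 e_i + Σ_{e : i ∈ scope (C e)} e_{N+e}` for `i < N` and `b_{N+e} = 2 e_{N+e}`; block
upper triangular with determinant `2^(N+me)`. (line vocabulary) -/
def conABasis (N me : ℕ) (C : Fin me → Clause ℕ) : Matrix (Fin (N + me)) (Fin (N + me)) ℤ :=
  Matrix.reindex finSumFinEquiv finSumFinEquiv
    (Matrix.fromBlocks (Matrix.diagonal fun _ => 2) (incBlock N me C) 0 (Matrix.diagonal fun _ => 2))

/-- The Construction-A target `t = (1, …, 1 | rhsBit (C e))`: the deep hole `(1, …, 1)` of `2ℤ^N` in the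
message block, the XOR right-hand sides in the check block. (line vocabulary) -/
def conATarget (N me : ℕ) (C : Fin me → Clause ℕ) : Fin (N + me) → ℤ :=
  fun k => Sum.elim (fun _ => (1 : ℤ)) (fun e => rhsBit (C e)) (finSumFinEquiv.symm k)

/-- The Construction-A `GapCVP` instance `((B, t), d₀)` of the clause family with threshold `d₀`.
(line vocabulary) -/
def conAInstance (N me : ℕ) (C : Fin me → Clause ℕ) (d₀ : ℚ) : GapCVPInstance :=
  (⟨⟨N + me, conABasis N me C⟩, conATarget N me C⟩, d₀)

/-- INTEGER-PARITY UNSATISFIABILITY of the scope system: for every integer vector `u ∈ ℤ^N` some check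
`e` has `Σ_i u_i · [i ∈ scope (C e)] ≢ rhsBit (C e) (mod 2)` (the sum is written exactly as the
check-block coordinate of `u ᵥ* incBlock`). This is what makes every lattice vector pay `≥ 1` on some
check coordinate. (line vocabulary) -/
def XorUnsat (N me : ℕ) (C : Fin me → Clause ℕ) : Prop :=
  ∀ u : Fin N → ℤ, ∃ e : Fin me,
    ¬ (2 : ℤ) ∣ (∑ i : Fin N, u i * (if (i : ℕ) ∈ clauseScope (C e) then 1 else 0)) - rhsBit (C e)

/-! ## §3 Elementary sanity facts -/

/-- The dimension of the Construction-A instance is `N + me` (definitionally). (line vocabulary) -/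
@[simp] theorem conAInstance_n (N me : ℕ) (C : Fin me → Clause ℕ) (d₀ : ℚ) :
    (conAInstance N me C d₀).1.I.n = N + me := rfl

/-- The threshold of the Construction-A instance is `d₀` (definitionally). (line vocabulary) -/
@[simp] theorem conAInstance_snd (N me : ℕ) (C : Fin me → Clause ℕ) (d₀ : ℚ) :
    (conAInstance N me C d₀).2 = d₀ := rfl

/-- `rhsBit C ∈ {0, 1}`. (line vocabulary) -/
theorem rhsBit_eq_zero_or_one (C : Clause ℕ) : rhsBit C = 0 ∨ rhsBit C = 1 := by
  unfold rhsBit; split_ifs <;> simp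

end

end Summit.PneNP.PneNP.Theorems.ConA
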